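import Summits.QuantumFields.YangMills.Theorems.BalabanUVNodesC44IterMhHierFrameNearOne
import HarnessLib

/-!
# (ℓa-C)ᵖʳ PARAMETRIC IN THE FRAME CONSTANT — F5ᵖʳ RE-PRESSED: `Prop4LetterCPrAtRecord … 𝔥 levB (C₂(c𝔥)) ((2·10¹¹·L·N)⁻¹)` with
# `C₂(c𝔥) = (6.4·10¹²·c𝔥 + 2.56·10¹⁶)·L·N` for EVERY datum `𝔥` carrying (hdom)∕(hnear) with window constant `c𝔥` A BINDER; AND THE RECORD INSTANCE at
# `𝔥 := hierFrameDatumOfRecord F N k U₀` with (hdom)∕(hnear)∕`hc` ALL DISCHARGED (c𝔥 = 40000 ⇒ C₂ = 2.816·10¹⁷·L·N)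

Cell `pub-ymgap` ∕ `ym-nodeO-ideate`, porter lineage `ymgap-nodeO-port-PTB-1` (gen 10); director-ym g24 №630 (2): «the re-press is COMMISSIONED to PT-B in the PARAMETRIC form ONLY:
the window constant becomes a binder `c𝔥` with every downstream constant an explicit function of it; deprecate-and-add, new decl names, the `≤ 1000` editions stay as the special
case they are».  `--kind proof --supports stmt-QuantumFields-27238 --as helper`; count-neutral; NEW basename; nothing appended, nothing re-declared.
[B7] = [Balaban1985Averaging]; [B11] = [Balaban1985Variational]; [I] = [Balaban1987RG1].

WHAT CHANGES AGAINST F5ᵖʳ ✓`prop4LetterCPrAtRecord_of_loopProfile` (c𝔥 ≤ 10³, C₂ = 3.2·10¹⁶·L·N).  The window constant is a binder `(hc0 : 0 ≤ c𝔥) (hc : c𝔥 ≤ 10¹⁰)`; the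
cap is the VALIDITY RANGE of the FIXED chart radius `c₄ = (2·10¹¹·L·N)⁻¹` — on the traceless scaled polydisc `L^k‖Y‖ < ρ₀ = (2.5·10¹⁰·L·N)⁻¹ ≤ (3·10¹¹)⁻¹` the framed relative
average obeys `‖Ū^{pr}(e^{iY}U₀)Ū₀⋆ − 1‖ ≤ (4c𝔥 + 16000)·L^k‖Y‖ ≤ (4·10¹⁰ + 16000)∕(3·10¹¹) < ½`, inside `log`'s disc — not a threshold on any inhabitant (the record's
`c𝔥 = 40000` of ✓`…HierFrameNearOne` is discharged by `norm_num` in §2).  Every constant downstream is the displayed function of `c𝔥`: linear bound `(8c𝔥 + 32000)·L^k‖Y‖` on the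
framed log-chart ([B7] (26)), Cauchy constant `8·(8c𝔥 + 32000)∕ρ₀` (F4′-0ᵖʳ ✓`norm_framedLogChart_sub_qPrCplxOp_le_of_linearBound`), `(L^k‖X‖)² ≤ 4‖A′‖²` ⇒
`C₂(c𝔥) = 32·2.5·10¹⁰·(8c𝔥 + 32000)·L·N = (6.4·10¹²·c𝔥 + 2.56·10¹⁶)·L·N` (`c𝔥 = 1000` ↦ `3.2·10¹⁶·L·N`, today's edition).

WHAT IS PROVED (0 def, 0 sorry, axioms standard; ns `Summit.QuantumFields.YangMills.Theorems.C44IterMh`):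
* §1 ★ `norm_avPrM_expOver_mul_star_sub_one_le_of_loopProfile_param` (`‖Ū^{pr}Ū₀⋆ − 1‖ ≤ (4c𝔥 + 16000)·L^k‖Y‖`); ★★★ `prop4LetterCPrAtRecord_of_loopProfile_param` — THE FRAMED
  (ℓa-C) LETTER at `(C₂(c𝔥), c₄)` for EVERY datum `𝔥` carrying (hdom)∕(hnear) with constant `c𝔥 ∈ [0, 10¹⁰]`.
* §2 ★★★ `prop4LetterCPrAtRecord_hierFrame_of_loopProfile` — THE RECORD INSTANCE: at `𝔥 := hierFrameDatumOfRecord F N k U₀` ((A1) ✓`Node00.BgHierFrameOfRecord`) the letter holds at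
  `(C₂, c₄) = (2.816·10¹⁷·L·N, (2·10¹¹·L·N)⁻¹)` under F5's loop-profile rows ALONE — (hdom)∕(hnear) by ✓`hierFrameDatumOfRecord_hdom`∕`_hnear` ((T1)∕(T2), c𝔥 = 40000), `hc` by
  `norm_num`; no frame hypothesis survives.

HONEST FRAMING.  (ℓa-C)ᵖʳ in the small-field approximation (`Ω_k = T`) under the displayed summable loop profile of the background tower (supplied at the record by
✓`loopProfile_of_regular` from print's (14)); constants crude; (ℓa-H)ᵖʳ, (ℓd)ᵖʳ, (KL-·) letters DISPLAYED elsewhere, unchanged; (R1)∕(R2) OPEN; K0ᴬ ⟨stmt-QuantumFields-27238⟩ NOT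
closed; NODE O 0∕1; COUNT 8∕28 · K 1∕4 UNMOVED; finite `𝕋⁴_{L^K}` at fixed ε — NOT continuum ∕ ℝ⁴ ∕ OS ∕ Clay; **the Yang–Mills mass gap (Clay) is NOT proved by any of this.**
No `sorry`, `instance`, `notation`, `set_option`; standard axioms.
-/

noncomputable section

open scoped Matrix Matrix.Norms.L2Operator InnerProductSpace ComplexConjugate Topology

namespace Summit.QuantumFields.YangMills.Theorems.C44IterMh

open Literature.MathematicalPhysics.QuantumFieldTheory.Balaban1983to89
open Literature.MathematicalPhysics.QuantumFieldTheory.Balaban1983to89.Node00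
open BlockAveraging
open B15AveragingHolomorphic (iterMh loopMh differentiableAt_iterMh coeField_iter_eq_iterMh)
open ExpMeanLog (expMeanLogSU)
open T4Continuum BlockAveraging
open B11Eq115Space (NegSup NegSize levWeight levWeight_apply)
open NormedSpace (exp)
open Filter Metric Set
open MatrixLog (mlog)

/-! ## §1  The framed (ℓa-C) letter with the window constant a binder -/

section RecordPrParam

variable (F : T4Family) (N : ℕ) [NeZero N] {K : ℕ} (k : ℕ) (Ω : ℕ → Set (Site (F.P K) 0)) (U₀ : GaugeField (F.P K) 0 (SU N))

/-- ★ **THE FRAMED RELATIVE AVERAGE IS NEAR `1` ON THE POLYDISC, PARAMETRIC IN `c𝔥`**: `‖Ū^{pr}(e^{iY}U₀)(c)·Ū₀(c)⋆ − 1‖ ≤ (4c𝔥 + 16000)·L^k‖Y‖` for traceless `Y` with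
`L^k‖Y‖ < (2.5·10¹⁰·L·N)⁻¹`, from the package (`δ = 8000·L^k‖Y‖`) and the DISPLAYED frame bound with constant `c𝔥 ∈ [0, 10¹⁰]` (`(1+θ)(1+δ)(1+θ) − 1 ≤ 2(2θ+δ)` needs
`2θ + δ ≤ 1`: `(2·10¹⁰ + 8000)∕(3·10¹¹) < 1`). [cite: Balaban1985Averaging, (92) p.31, Proposition 3 p.36; Balaban1985Variational, (51)–(53) p.286] -/
theorem norm_avPrM_expOver_mul_star_sub_one_le_of_loopProfile_param (𝔥 : FrameDatum (F.P K) N k U₀) (hU₀ : SmallBelow (avOfRecord F N K) k U₀)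
    (εs : ℕ → ℝ) (hε0 : ∀ j, 0 ≤ εs j)
    (hε : ∀ j, j < k → ∀ (c : PBond (F.P K) (j + 1)) (i : Idx (F.P K)), ‖loopM (coeField (Averaging.iter (avOfRecord F N K) j U₀)) c i - 1‖ ≤ εs j)
    (hε50 : ∀ j, j < k → εs j ≤ 1 / 50) (hNε : ∀ j, j < k → (N : ℝ) * εs j ≤ 2) (hεsum : 300000 * (Finset.range k).sum εs ≤ 1 / 4)
    {c𝔥 : ℝ} (hc0 : 0 ≤ c𝔥) (hc : c𝔥 ≤ 10000000000)
    (hnear : ∀ Y : PBond (F.P K) 0 → Matrix (Fin N) (Fin N) ℂ, (∀ b, (Y b).trace = 0) → (F.L : ℝ) ^ k * ‖Y‖ < 1 / (25000000000 * (F.L : ℝ) * N) →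
      ∀ y : Site (F.P K) k, ‖𝔥.map (expOver U₀ Y) y - 1‖ ≤ c𝔥 * ((F.L : ℝ) ^ k * ‖Y‖) ∧ ‖𝔥.inv (expOver U₀ Y) y - 1‖ ≤ c𝔥 * ((F.L : ℝ) ^ k * ‖Y‖))
    {Y : PBond (F.P K) 0 → Matrix (Fin N) (Fin N) ℂ} (hY : ∀ b, (Y b).trace = 0) (hsmall : (F.L : ℝ) ^ k * ‖Y‖ < 1 / (25000000000 * (F.L : ℝ) * N))
    (c : PBond (F.P K) k) :
    ‖avPrM 𝔥 (expOver U₀ Y) c * star ((Averaging.iter (fun j => blockAvg (P := F.P K) (j := j) expMeanLogSU) k U₀ c : SU N) : Matrix (Fin N) (Fin N) ℂ) - 1‖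
      ≤ (4 * c𝔥 + 16000) * ((F.L : ℝ) ^ k * ‖Y‖) := by
  have hN1 : (1 : ℝ) ≤ N := by exact_mod_cast Nat.one_le_iff_ne_zero.2 (NeZero.ne N)
  have hL12 : (12 : ℝ) ≤ F.L := by exact_mod_cast F.hL11
  obtain ⟨-, hl⟩ := polydiscPackage_of_loopProfile F N k U₀ hU₀ εs hε0 hε hε50 hNε hεsum hY hsmall
  have hmi := hnear Y hY hsmall
  have hs0 : 0 ≤ (F.L : ℝ) ^ k * ‖Y‖ := by positivity
  have hρ : (F.L : ℝ) ^ k * ‖Y‖ ≤ 1 / 300000000000 := by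
    refine hsmall.le.trans (one_div_le_one_div_of_le (by norm_num) ?_)
    nlinarith [mul_le_mul hL12 hN1 (by norm_num) (by linarith : (0:ℝ) ≤ F.L)]
  have hθ : 0 ≤ c𝔥 * ((F.L : ℝ) ^ k * ‖Y‖) := by positivity
  have hcρ : c𝔥 * ((F.L : ℝ) ^ k * ‖Y‖) ≤ 10000000000 * (1 / 300000000000) := mul_le_mul hc hρ hs0 (by norm_num)
  have hσ : c𝔥 * ((F.L : ℝ) ^ k * ‖Y‖) + 8000 * ((F.L : ℝ) ^ k * ‖Y‖) + c𝔥 * ((F.L : ℝ) ^ k * ‖Y‖) ≤ 1 := by linarith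
  have hp := prod3_sub_one_le_two_mul hθ (by positivity : (0:ℝ) ≤ 8000 * ((F.L : ℝ) ^ k * ‖Y‖)) hθ hσ
  refine (norm_avPrM_mul_star_sub_one_le 𝔥 (expOver U₀ Y) c (hmi c.src).1 (hmi c.tgt).2 (hl c)).trans ?_
  refine hp.trans (le_of_eq ?_)
  ring

/-- ★★★ **THE FRAMED (44) AT THE RECORD, PARAMETRIC IN THE FRAME CONSTANT — `Prop4LetterCPrAtRecord … 𝔥 levB ((6.4·10¹²·c𝔥 + 2.56·10¹⁶)·L·N) ((2·10¹¹·L·N)⁻¹)`** from the loop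
profile of the real tower (F5's hypotheses VERBATIM) and the TWO DISPLAYED frame bounds on the traceless scaled polydisc `L^k‖Y‖ < ρ₀ = (2.5·10¹⁰·L·N)⁻¹` — (hdom) the chart field
lies in the frame's window, (hnear) the frame and its inverse are within `c𝔥·L^k‖Y‖` of `1` there — with the window constant `c𝔥` A BINDER, `0 ≤ c𝔥 ≤ 10¹⁰` (the validity range of
the fixed radius `c₄ = ρ₀∕8`).  Proof = F5ᵖʳ re-run with `(4c𝔥 + 16000)` in place of `2·10⁴`: linear bound `(8c𝔥 + 32000)·L^k‖Y‖` on the framed log-chart and its analyticity, then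
F4′-0ᵖʳ's Cauchy estimate with `C₀ = 8c𝔥 + 32000`, `8C₀∕ρ₀·(L^k‖X‖)² ≤ 32·2.5·10¹⁰·C₀·L·N·‖A′‖²`.
[cite: Balaban1985Variational, (44) p.285, Prop. 4 (97)–(98) pp.292–293, (51)–(53) p.286; Balaban1985Averaging, (92) p.31, Proposition 3 p.36; Balaban1987RG1, (0.8) p.253] -/
theorem prop4LetterCPrAtRecord_of_loopProfile_param [Fact (0 < (F.L : ℝ))] [Fact (0 < (F.P K).eta k)] [Fact (0 < c0Rec F K k)] [Fact (∀ c, 0 < wBRec F K k c)]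
    (𝔥 : FrameDatum (F.P K) N k U₀) (levB : PBond (F.P K) k → ℕ) (hU₀ : SmallBelow (avOfRecord F N K) k U₀) (hΩ : ∀ x, x ∈ Ω k)
    (εs : ℕ → ℝ) (hε0 : ∀ j, 0 ≤ εs j)
    (hε : ∀ j, j < k → ∀ (c : PBond (F.P K) (j + 1)) (i : Idx (F.P K)), ‖loopM (coeField (Averaging.iter (avOfRecord F N K) j U₀)) c i - 1‖ ≤ εs j)
    (hε50 : ∀ j, j < k → εs j ≤ 1 / 50) (hNε : ∀ j, j < k → (N : ℝ) * εs j ≤ 2) (hεsum : 300000 * (Finset.range k).sum εs ≤ 1 / 4)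
    {c𝔥 : ℝ} (hc0 : 0 ≤ c𝔥) (hc : c𝔥 ≤ 10000000000)
    (hdom : ∀ Y : PBond (F.P K) 0 → Matrix (Fin N) (Fin N) ℂ, (∀ b, (Y b).trace = 0) → (F.L : ℝ) ^ k * ‖Y‖ < 1 / (25000000000 * (F.L : ℝ) * N) →
      expOver U₀ Y ∈ 𝔥.dom)
    (hnear : ∀ Y : PBond (F.P K) 0 → Matrix (Fin N) (Fin N) ℂ, (∀ b, (Y b).trace = 0) → (F.L : ℝ) ^ k * ‖Y‖ < 1 / (25000000000 * (F.L : ℝ) * N) →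
      ∀ y : Site (F.P K) k, ‖𝔥.map (expOver U₀ Y) y - 1‖ ≤ c𝔥 * ((F.L : ℝ) ^ k * ‖Y‖) ∧ ‖𝔥.inv (expOver U₀ Y) y - 1‖ ≤ c𝔥 * ((F.L : ℝ) ^ k * ‖Y‖)) :
    Prop4LetterCPrAtRecord F N K k Ω U₀ 𝔥 levB ((6400000000000 * c𝔥 + 25600000000000000) * (F.L : ℝ) * N) (1 / (200000000000 * (F.L : ℝ) * N)) := by
  -- constants and casts (as in F5ᵖʳ)
  have hN1 : (1 : ℝ) ≤ N := by exact_mod_cast Nat.one_le_iff_ne_zero.2 (NeZero.ne N)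
  have hL12 : (12 : ℝ) ≤ F.L := by exact_mod_cast F.hL11
  have hPL : ((F.P K).L : ℝ) = F.L := by rw [T4Family.P_L]
  have hLN : 0 < (F.L : ℝ) * N := by positivity
  have hLN1 : (1 : ℝ) ≤ (F.L : ℝ) * N := one_le_mul_of_one_le_of_one_le (by linarith) hN1
  set ρ₀ : ℝ := 1 / (25000000000 * (F.L : ℝ) * N) with hρ₀
  have hρ₀pos : 0 < ρ₀ := by positivity
  have hρ₀le : ρ₀ ≤ 1 / 300000000000 := by
    rw [hρ₀]
    refine one_div_le_one_div_of_le (by norm_num) ?_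
    nlinarith [mul_le_mul hL12 hN1 (by norm_num) (by linarith : (0:ℝ) ≤ F.L)]
  have hc₄' : 1 / (200000000000 * (F.L : ℝ) * N) = ρ₀ / 8 := by
    rw [hρ₀, div_div]; congr 1; ring
  have hC₀ : (0 : ℝ) ≤ 8 * c𝔥 + 32000 := by positivity
  -- the window: `(4c𝔥 + 16000)·L^k‖Y‖ ≤ ½` on the polydisc
  have hB : ∀ Y : PBond (F.P K) 0 → Matrix (Fin N) (Fin N) ℂ, (F.L : ℝ) ^ k * ‖Y‖ < ρ₀ → (4 * c𝔥 + 16000) * ((F.L : ℝ) ^ k * ‖Y‖) ≤ 1 / 2 := by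
    intro Y hsmall
    have hs0 : 0 ≤ (F.L : ℝ) ^ k * ‖Y‖ := by positivity
    have h1 : (4 * c𝔥 + 16000) * ((F.L : ℝ) ^ k * ‖Y‖) ≤ (4 * 10000000000 + 16000) * (1 / 300000000000) :=
      mul_le_mul (by linarith) (hsmall.le.trans hρ₀le) hs0 (by norm_num)
    linarith [show (4 * 10000000000 + 16000 : ℝ) * (1 / 300000000000) ≤ 1 / 2 by norm_num]
  -- the framed chart is analytic with the linear bound `(8c𝔥 + 32000)·L^k‖Y‖` on the traceless scaled polydisc
  have hdiff : ∀ Y : PBond (F.P K) 0 → Matrix (Fin N) (Fin N) ℂ, (∀ b, (Y b).trace = 0) → ((F.P K).L : ℝ) ^ k * ‖Y‖ < ρ₀ →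
      DifferentiableAt ℂ (fun Y : PBond (F.P K) 0 → Matrix (Fin N) (Fin N) ℂ =>
        logOver (coeField (Averaging.iter (fun j => blockAvg (P := F.P K) (j := j) expMeanLogSU) k U₀)) (avPrM 𝔥 (expOver U₀ Y))) Y := by
    intro Y hY hsmall
    rw [hPL] at hsmall
    obtain ⟨hp, -⟩ := polydiscPackage_of_loopProfile F N k U₀ hU₀ εs hε0 hε hε50 hNε hεsum hY hsmall
    refine (analyticAt_framedLogChart 𝔥 (hdom Y hY hsmall) (fun j hj c i => lt_of_le_of_lt (hp j hj c i) (by norm_num)) fun c =>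
      lt_of_le_of_lt (norm_avPrM_expOver_mul_star_sub_one_le_of_loopProfile_param F N k U₀ 𝔥 hU₀ εs hε0 hε hε50 hNε hεsum hc0 hc hnear hY hsmall c) ?_).differentiableAt
    linarith [hB Y hsmall]
  have hbound : ∀ Y : PBond (F.P K) 0 → Matrix (Fin N) (Fin N) ℂ, (∀ b, (Y b).trace = 0) → ((F.P K).L : ℝ) ^ k * ‖Y‖ < ρ₀ →
      ‖logOver (coeField (Averaging.iter (fun j => blockAvg (P := F.P K) (j := j) expMeanLogSU) k U₀)) (avPrM 𝔥 (expOver U₀ Y))‖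
        ≤ (8 * c𝔥 + 32000) * (((F.P K).L : ℝ) ^ k * ‖Y‖) := by
    intro Y hY hsmall
    rw [hPL] at hsmall ⊢
    have hY0 : 0 ≤ (F.L : ℝ) ^ k * ‖Y‖ := by positivity
    have h := norm_logOver_le_two_mul' U₀ k (by positivity) (hB Y hsmall)
      (norm_avPrM_expOver_mul_star_sub_one_le_of_loopProfile_param F N k U₀ 𝔥 hU₀ εs hε0 hε hε50 hNε hεsum hc0 hc hnear hY hsmall)
    refine h.trans (le_of_eq ?_)
    ring
  refine ⟨fun A hA => ?_, fun A hA => ?_⟩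
  · -- the quadratic bound
    have hA0 := norm_nonneg A
    set X : PBond (F.P K) 0 → Matrix (Fin N) (Fin N) ℂ := ((((F.P K).eta k : ℝ) : ℂ)) • evLit F N K k Ω U₀ (slProjLit F N K k Ω U₀ A) with hX
    have hXtr : ∀ b, (X b).trace = 0 := fun b => by
      rw [hX, Pi.smul_apply, Matrix.trace_smul, evLit_apply, trace_equiv_slProjLit (F := F) (N := N) (K := K) (k := k) (Ω := Ω) (U₀ := U₀) A _, smul_zero]
    have hXn : (F.L : ℝ) ^ k * ‖X‖ ≤ 2 * ‖A‖ := norm_scaled_evLit_slProjLit_le F N k Ω U₀ hΩ A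
    have hc₄ : 2 * (1 / (200000000000 * (F.L : ℝ) * N)) ≤ ρ₀ / 4 := by rw [hc₄']; linarith
    have hXρ : 4 * (((F.P K).L : ℝ) ^ k * ‖X‖) ≤ ρ₀ := by rw [hPL]; linarith
    have hmain := norm_framedLogChart_sub_qPrCplxOp_le_of_linearBound 𝔥 hU₀ hC₀ hdiff hbound hXtr hXρ
    rw [hPL] at hmain
    have hC : 8 * (8 * c𝔥 + 32000) / ρ₀ * ((F.L : ℝ) ^ k * ‖X‖) ^ 2 ≤ (6400000000000 * c𝔥 + 25600000000000000) * (F.L : ℝ) * N * ‖A‖ ^ 2 := by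
      have h1 : ((F.L : ℝ) ^ k * ‖X‖) ^ 2 ≤ (2 * ‖A‖) ^ 2 := pow_le_pow_left₀ (by positivity) hXn 2
      have h2 : 8 * (8 * c𝔥 + 32000) / ρ₀ = 8 * (8 * c𝔥 + 32000) * (25000000000 * (F.L : ℝ) * N) := by
        rw [hρ₀, div_div_eq_mul_div, div_one]
      rw [h2]
      calc 8 * (8 * c𝔥 + 32000) * (25000000000 * (F.L : ℝ) * N) * ((F.L : ℝ) ^ k * ‖X‖) ^ 2
          ≤ 8 * (8 * c𝔥 + 32000) * (25000000000 * (F.L : ℝ) * N) * (2 * ‖A‖) ^ 2 := mul_le_mul_of_nonneg_left h1 (by positivity)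
        _ = (6400000000000 * c𝔥 + 25600000000000000) * (F.L : ℝ) * N * ‖A‖ ^ 2 := by ring
    refine (NegSup.norm_le_iff (by positivity)).2 fun c => ?_
    rw [levWeight_apply, pow_zero, one_mul, equiv_CslprOfRecord_eq F N k Ω U₀ 𝔥 levB A c]
    exact (norm_le_pi_norm _ c).trans (hmain.trans hC)
  · -- differentiability on the ball: `C^{sl,pr} = C^{pr} ∘ P` is analytic at `A′`
    have hXn : (F.L : ℝ) ^ k * ‖((((F.P K).eta k : ℝ) : ℂ)) • evLit F N K k Ω U₀ (slProjLit F N K k Ω U₀ A)‖ ≤ 2 * ‖A‖ := norm_scaled_evLit_slProjLit_le F N k Ω U₀ hΩ A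
    have hXtr : ∀ b, ((((((F.P K).eta k : ℝ) : ℂ)) • evLit F N K k Ω U₀ (slProjLit F N K k Ω U₀ A)) b).trace = 0 := fun b => by
      rw [Pi.smul_apply, Matrix.trace_smul, evLit_apply, trace_equiv_slProjLit (F := F) (N := N) (K := K) (k := k) (Ω := Ω) (U₀ := U₀) A _, smul_zero]
    have hsmall : (F.L : ℝ) ^ k * ‖((((F.P K).eta k : ℝ) : ℂ)) • evLit F N K k Ω U₀ (slProjLit F N K k Ω U₀ A)‖ < ρ₀ := by
      have hA' : ‖A‖ < 1 / (200000000000 * (F.L : ℝ) * N) := hA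
      have : 2 * (1 / (200000000000 * (F.L : ℝ) * N)) ≤ ρ₀ := by rw [hc₄']; linarith
      linarith
    obtain ⟨hp, -⟩ := polydiscPackage_of_loopProfile F N k U₀ hU₀ εs hε0 hε hε50 hNε hεsum hXtr hsmall
    have han : AnalyticAt ℂ (CprOfRecord F N K k Ω U₀ 𝔥 levB) (slProjLit F N K k Ω U₀ A) :=
      analyticAt_CprOfRecord F N K k Ω U₀ 𝔥 levB _ (hdom _ hXtr hsmall) (fun j hj c i => lt_of_le_of_lt (hp j hj c i) (by norm_num)) fun c =>
        lt_of_le_of_lt (norm_avPrM_expOver_mul_star_sub_one_le_of_loopProfile_param F N k U₀ 𝔥 hU₀ εs hε0 hε hε50 hNε hεsum hc0 hc hnear hXtr hsmall c)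
          (by linarith [hB _ hsmall])
    exact (han.comp ((slProjLit F N K k Ω U₀).analyticAt A)).differentiableAt.differentiableWithinAt

/-! ## §2  The record instance: the hierarchical frame datum, every frame hypothesis discharged -/

/-- ★★★ **THE FRAMED (44) AT THE RECORD'S OWN DATUM, NO FRAME HYPOTHESIS LEFT**: at `𝔥 := hierFrameDatumOfRecord F N k U₀` (print's hierarchical frame (84)–(87) of order `k`)
`Prop4LetterCPrAtRecord … (hierFrameDatumOfRecord F N k U₀) levB (2.816·10¹⁷·L·N) ((2·10¹¹·L·N)⁻¹)` from F5's loop-profile rows ALONE: (hdom)∕(hnear) are the theorems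
✓`hierFrameDatumOfRecord_hdom`∕`_hnear` ((T1)∕(T2) with the k-free constant `c𝔥 = 40000`) and `2.816·10¹⁷ = 6.4·10¹²·40000 + 2.56·10¹⁶`.
[cite: Balaban1985Variational, (44) p.285, Prop. 4 (97)–(98) pp.292–293; Balaban1985Averaging, (81) p.30, (89) p.31, (92) p.31, Proposition 3 p.36; Balaban1987RG1, (0.8) p.253] -/
theorem prop4LetterCPrAtRecord_hierFrame_of_loopProfile [Fact (0 < (F.L : ℝ))] [Fact (0 < (F.P K).eta k)] [Fact (0 < c0Rec F K k)] [Fact (∀ c, 0 < wBRec F K k c)]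
    (levB : PBond (F.P K) k → ℕ) (hU₀ : SmallBelow (avOfRecord F N K) k U₀) (hΩ : ∀ x, x ∈ Ω k)
    (εs : ℕ → ℝ) (hε0 : ∀ j, 0 ≤ εs j)
    (hε : ∀ j, j < k → ∀ (c : PBond (F.P K) (j + 1)) (i : Idx (F.P K)), ‖loopM (coeField (Averaging.iter (avOfRecord F N K) j U₀)) c i - 1‖ ≤ εs j)
    (hε50 : ∀ j, j < k → εs j ≤ 1 / 50) (hNε : ∀ j, j < k → (N : ℝ) * εs j ≤ 2) (hεsum : 300000 * (Finset.range k).sum εs ≤ 1 / 4) :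
    Prop4LetterCPrAtRecord F N K k Ω U₀ (hierFrameDatumOfRecord F N k U₀) levB (281600000000000000 * (F.L : ℝ) * N) (1 / (200000000000 * (F.L : ℝ) * N)) := by
  have h := prop4LetterCPrAtRecord_of_loopProfile_param F N k Ω U₀ (hierFrameDatumOfRecord F N k U₀) levB hU₀ hΩ εs hε0 hε hε50 hNε hεsum
    (c𝔥 := 40000) (by norm_num) (by norm_num)
    (hierFrameDatumOfRecord_hdom F N k U₀ hU₀ εs hε0 hε hε50 hNε hεsum) (hierFrameDatumOfRecord_hnear F N k U₀ hU₀ εs hε0 hε hε50 hNε hεsum)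
  have e : (6400000000000 * (40000 : ℝ) + 25600000000000000) * (F.L : ℝ) * N = 281600000000000000 * (F.L : ℝ) * N := by norm_num
  rw [e] at h
  exact h

end RecordPrParam

/-! ## §3  The cap `c𝔥 ≤ 10¹⁰` IS the validity range of the fixed chart radius (director-ym №632 (1) ∕ ◆ C33 (5): one named one-liner) -/

/-- ★ **THE CAP READS AS WHAT IT IS**: for `c𝔥 ≤ 10¹⁰` (no sign needed), `L ≥ 12`, `N ≥ 1` the window condition the proof of ✓`prop4LetterCPrAtRecord_of_loopProfile_param` uses holds —
`(4c𝔥 + 16000)·ρ₀ ≤ ½` with `ρ₀ = (2.5·10¹⁰·L·N)⁻¹` the FIXED scale of the chart radius `c₄ = ρ₀∕8` (so the framed relative average `Ū^{pr}Ū₀⋆` stays in `log`'s disc); the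
numeral `10¹⁰` is a validity range of that fixed radius, not a threshold on any inhabitant (the record's `c𝔥 = 40000`, §2). [cite: Balaban1985Averaging, (92) p.31, (21) p.21; Balaban1985Variational, (51)–(53) p.286] -/
theorem cap_mul_rho0_le_half {c𝔥 L N : ℝ} (hc : c𝔥 ≤ 10000000000) (hL : 12 ≤ L) (hN : 1 ≤ N) :
    (4 * c𝔥 + 16000) * (1 / (25000000000 * L * N)) ≤ 1 / 2 := by
  have hρ : 1 / (25000000000 * L * N) ≤ 1 / 300000000000 :=
    one_div_le_one_div_of_le (by norm_num) (by nlinarith [mul_le_mul hL hN (by norm_num) (by linarith : (0:ℝ) ≤ L)])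
  have h1 : (4 * c𝔥 + 16000) * (1 / (25000000000 * L * N)) ≤ (4 * 10000000000 + 16000) * (1 / 300000000000) :=
    mul_le_mul (by linarith) hρ (by positivity) (by norm_num)
  linarith [show (4 * 10000000000 + 16000 : ℝ) * (1 / 300000000000) ≤ 1 / 2 by norm_num]

/-- ★ **… AND ON THE POLYDISC**: for a torus family (`L ≥ 12`) and `N ≥ 1`, every `Y` with `L^k‖Y‖ < ρ₀` satisfies `(4c𝔥 + 16000)·L^k‖Y‖ ≤ ½` whenever `c𝔥 ≤ 10¹⁰` — the
`hB` step inside ✓`prop4LetterCPrAtRecord_of_loopProfile_param`, named. [cite: Balaban1985Averaging, (92) p.31; Balaban1985Variational, (51)–(53) p.286] -/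
theorem cap_window_le_half (F : T4Family) (N : ℕ) [NeZero N] {K : ℕ} (k : ℕ) {c𝔥 : ℝ} (hc : c𝔥 ≤ 10000000000)
    {Y : PBond (F.P K) 0 → Matrix (Fin N) (Fin N) ℂ} (hsmall : (F.L : ℝ) ^ k * ‖Y‖ < 1 / (25000000000 * (F.L : ℝ) * N)) :
    (4 * c𝔥 + 16000) * ((F.L : ℝ) ^ k * ‖Y‖) ≤ 1 / 2 := by
  have hN1 : (1 : ℝ) ≤ N := by exact_mod_cast Nat.one_le_iff_ne_zero.2 (NeZero.ne N)
  have hL12 : (12 : ℝ) ≤ F.L := by exact_mod_cast F.hL11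
  have h := cap_mul_rho0_le_half hc hL12 hN1
  have hs0 : 0 ≤ (F.L : ℝ) ^ k * ‖Y‖ := by positivity
  rcases le_or_gt 0 (4 * c𝔥 + 16000) with hpos | hneg
  · exact (mul_le_mul_of_nonneg_left hsmall.le hpos).trans h
  · have : (4 * c𝔥 + 16000) * ((F.L : ℝ) ^ k * ‖Y‖) ≤ 0 := mul_nonpos_of_nonpos_of_nonneg hneg.le hs0
    linarith

end Summit.QuantumFields.YangMills.Theorems.C44IterMh

end
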